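import Literature.Algebra.Polynomial.CasasAlvero.Char257Digits
import Literature.Algebra.Polynomial.CasasAlvero.Char257DigitsHigh
import Literature.Algebra.Polynomial.CasasAlvero.Degree7Char257
import Literature.Algebra.Polynomial.CasasAlvero.Pentanomial
import Literature.Algebra.Polynomial.CasasAlvero.Degree6BadPrimes
import Literature.Algebra.Polynomial.CasasAlvero.FieldCorollaries
import Literature.Algebra.Polynomial.CasasAlvero.Degree5
import Literature.Algebra.Polynomial.CasasAlvero.DigitReduction
import HarnessLib

/-!
# Casas-Alvero degrees in characteristic 257: the complete classification — digit set `{1, 2, 3, 4, 5, 7}`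

Over EVERY field `K` of characteristic `257`: `CA_d(K) ⟺ d = 0 ∨ d = a·257^k` with `a ∈ {1, 2, 3, 4, 5, 7}` — the third prime characteristic
(after `131` and `193`, digit set `{1, 2, 3, 4, 6}`, `CharOneHundredThirtyOneComplete.lean`, `CharOneHundredNinetyThreeComplete.lean`) whose
Casas-Alvero digits are NOT an initial segment `{1, …, N(p)}`, and the first of this shape: the digit `6` is BAD — `257` is one of the `53` bad primes of
degree `6` [CastryckLaterveerOunaies2012, Thm. 4] (in the tree `Degree6BadPrimes.lean`, `not_holdsInDegree_six_of_char_257`: an explicit Casas-Alvero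
sextic with prime-field coefficients and witnesses) — while the digit `7` is GOOD: `257` is a good prime for degree `7` (`Degree7Char257.lean`,
`holdsInDegree_seven_of_char_257`: kernel-checked scenario certificates closing all `202` scenarios; the bad primes of degree `7` were computed in
[CastryckLaterveerOunaies2012, Thm. 4]), with `CA_{7·257^k}` descending from the algebraic closure.
Other ingredients: the digit reduction `CA_d ⇒ d = a·p^k ∧ CA_a` (`DigitReduction.lean`, any field); the positive digits `1, 2, 3, 4`
([GrafVonBothmerEtAl2007, Props. 2, 6]) and `5` (`Degree5.lean`: `257` is not one of the nine bad primes of degree `5`); and a refutation of every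
digit `8 ≤ a ≤ 256` over every field of characteristic `257`:
`23, 39, 47, 57, 68, 71, 72, 74, 75, 83, 84, 98, 103, 111, 118, 125, 127, 129, 137, 141, 145, 146, 150, 153, 155, 160, 165, 169, 176, 182, 188, 189, 193, 195, 198, 199, 201, 202, 203, 205, 207, 217, 219, 223, 225, 226, 227, 231, 235, 237, 238, 239, 244, 245, 249, 251, 253, 256` by the binomial criterion
(`m = 11, 7, 7, 4, 3, 7, 18, 21, 26, 19, 31, 18, 48, 17, 12, 33, 63, 28, 46, 25, 37, 53, 12, 51, 28, 67, 46, 61, 18, 57, 13, 3, 64, 87, 41, 5, 31, 18, 4, 102, 26, 21, 108, 92, 16, 65, 67, 115, 39, 64, 54, 94, 106, 5, 32, 11, 67, 2`) and the 191 remaining digits by the sparse `𝔽_257`-examples of `Char257Digits.lean` and `Char257DigitsHigh.lean`.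
-/

noncomputable section

open Polynomial

set_option maxRecDepth 8192

namespace Literature.Algebra.Polynomial.CasasAlvero

section CharTwoHundredFiftySeven

variable (K : Type*) [Field K] [CharP K 257]

set_option maxHeartbeats 1000000 in
/-- every digit `8 ≤ a < 257` fails: `¬ CA_a` over every field of characteristic `257` — the bad-prime computations of
[cite: CastryckLaterveerOunaies2012, Thm. 4] (degrees `≤ 7`) extended to every digit `8 ≤ a < 257` by explicit `𝔽_257`-rational examples and the
binomial criterion. [cite: GrafVonBothmerEtAl2007, Prop. 6] -/
theorem not_holdsInDegree_digit_of_char_twoHundredFiftySeven {a : ℕ} (h8 : 8 ≤ a) (hap : a < 257) : ¬ HoldsInDegree K a := by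
  haveI : Fact (Nat.Prime 257) := ⟨by norm_num⟩
  interval_cases a
  · exact not_holdsInDegree_eight_of_char_257 K
  · exact not_holdsInDegree_nine_of_char_257 K
  · exact not_holdsInDegree_ten_of_char_257 K
  · exact not_holdsInDegree_eleven_of_char_257 K
  · exact not_holdsInDegree_twelve_of_char_257 K
  · exact not_holdsInDegree_thirteen_of_char_257 K
  · exact not_holdsInDegree_fourteen_of_char_257 K
  · exact not_holdsInDegree_fifteen_of_char_257 K
  · exact not_holdsInDegree_sixteen_of_char_257 K
  · exact not_holdsInDegree_seventeen_of_char_257 K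
  · exact not_holdsInDegree_eighteen_of_char_257 K
  · exact not_holdsInDegree_nineteen_of_char_257 K
  · exact not_holdsInDegree_twenty_of_char_257 K
  · exact not_holdsInDegree_twentyOne_of_char_257 K
  · exact not_holdsInDegree_twentyTwo_of_char_257 K
  · exact not_holdsInDegree_of_choose_modEq_one K 257 (d := 23) (m := 11) (by norm_num) (by norm_num) (by decide)
  · exact not_holdsInDegree_twentyFour_of_char_257 K
  · exact not_holdsInDegree_twentyFive_of_char_257 K
  · exact not_holdsInDegree_twentySix_of_char_257 K
  · exact not_holdsInDegree_twentySeven_of_char_257 K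
  · exact not_holdsInDegree_twentyEight_of_char_257 K
  · exact not_holdsInDegree_twentyNine_of_char_257 K
  · exact not_holdsInDegree_thirty_of_char_257 K
  · exact not_holdsInDegree_thirtyOne_of_char_257 K
  · exact not_holdsInDegree_thirtyTwo_of_char_257 K
  · exact not_holdsInDegree_thirtyThree_of_char_257 K
  · exact not_holdsInDegree_thirtyFour_of_char_257 K
  · exact not_holdsInDegree_thirtyFive_of_char_257 K
  · exact not_holdsInDegree_thirtySix_of_char_257 K
  · exact not_holdsInDegree_thirtySeven_of_char_257 K
  · exact not_holdsInDegree_thirtyEight_of_char_257 K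
  · exact not_holdsInDegree_of_choose_modEq_one K 257 (d := 39) (m := 7) (by norm_num) (by norm_num) (by decide)
  · exact not_holdsInDegree_forty_of_char_257 K
  · exact not_holdsInDegree_fortyOne_of_char_257 K
  · exact not_holdsInDegree_fortyTwo_of_char_257 K
  · exact not_holdsInDegree_fortyThree_of_char_257 K
  · exact not_holdsInDegree_fortyFour_of_char_257 K
  · exact not_holdsInDegree_fortyFive_of_char_257 K
  · exact not_holdsInDegree_fortySix_of_char_257 K
  · exact not_holdsInDegree_of_choose_modEq_one K 257 (d := 47) (m := 7) (by norm_num) (by norm_num) (by decide)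
  · exact not_holdsInDegree_fortyEight_of_char_257 K
  · exact not_holdsInDegree_fortyNine_of_char_257 K
  · exact not_holdsInDegree_fifty_of_char_257 K
  · exact not_holdsInDegree_fiftyOne_of_char_257 K
  · exact not_holdsInDegree_fiftyTwo_of_char_257 K
  · exact not_holdsInDegree_fiftyThree_of_char_257 K
  · exact not_holdsInDegree_fiftyFour_of_char_257 K
  · exact not_holdsInDegree_fiftyFive_of_char_257 K
  · exact not_holdsInDegree_fiftySix_of_char_257 K
  · exact not_holdsInDegree_of_choose_modEq_one K 257 (d := 57) (m := 4) (by norm_num) (by norm_num) (by decide)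
  · exact not_holdsInDegree_fiftyEight_of_char_257 K
  · exact not_holdsInDegree_fiftyNine_of_char_257 K
  · exact not_holdsInDegree_sixty_of_char_257 K
  · exact not_holdsInDegree_sixtyOne_of_char_257 K
  · exact not_holdsInDegree_sixtyTwo_of_char_257 K
  · exact not_holdsInDegree_sixtyThree_of_char_257 K
  · exact not_holdsInDegree_sixtyFour_of_char_257 K
  · exact not_holdsInDegree_sixtyFive_of_char_257 K
  · exact not_holdsInDegree_sixtySix_of_char_257 K
  · exact not_holdsInDegree_sixtySeven_of_char_257 K
  · exact not_holdsInDegree_of_choose_modEq_one K 257 (d := 68) (m := 3) (by norm_num) (by norm_num) (by decide)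
  · exact not_holdsInDegree_sixtyNine_of_char_257 K
  · exact not_holdsInDegree_seventy_of_char_257 K
  · exact not_holdsInDegree_of_choose_modEq_one K 257 (d := 71) (m := 7) (by norm_num) (by norm_num) (by decide)
  · exact not_holdsInDegree_of_choose_modEq_one K 257 (d := 72) (m := 18) (by norm_num) (by norm_num) (by decide)
  · exact not_holdsInDegree_seventyThree_of_char_257 K
  · exact not_holdsInDegree_of_choose_modEq_one K 257 (d := 74) (m := 21) (by norm_num) (by norm_num) (by decide)
  · exact not_holdsInDegree_of_choose_modEq_one K 257 (d := 75) (m := 26) (by norm_num) (by norm_num) (by decide)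
  · exact not_holdsInDegree_seventySix_of_char_257 K
  · exact not_holdsInDegree_seventySeven_of_char_257 K
  · exact not_holdsInDegree_seventyEight_of_char_257 K
  · exact not_holdsInDegree_seventyNine_of_char_257 K
  · exact not_holdsInDegree_eighty_of_char_257 K
  · exact not_holdsInDegree_eightyOne_of_char_257 K
  · exact not_holdsInDegree_eightyTwo_of_char_257 K
  · exact not_holdsInDegree_of_choose_modEq_one K 257 (d := 83) (m := 19) (by norm_num) (by norm_num) (by decide)
  · exact not_holdsInDegree_of_choose_modEq_one K 257 (d := 84) (m := 31) (by norm_num) (by norm_num) (by decide)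
  · exact not_holdsInDegree_eightyFive_of_char_257 K
  · exact not_holdsInDegree_eightySix_of_char_257 K
  · exact not_holdsInDegree_eightySeven_of_char_257 K
  · exact not_holdsInDegree_eightyEight_of_char_257 K
  · exact not_holdsInDegree_eightyNine_of_char_257 K
  · exact not_holdsInDegree_ninety_of_char_257 K
  · exact not_holdsInDegree_ninetyOne_of_char_257 K
  · exact not_holdsInDegree_ninetyTwo_of_char_257 K
  · exact not_holdsInDegree_ninetyThree_of_char_257 K
  · exact not_holdsInDegree_ninetyFour_of_char_257 K
  · exact not_holdsInDegree_ninetyFive_of_char_257 K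
  · exact not_holdsInDegree_ninetySix_of_char_257 K
  · exact not_holdsInDegree_ninetySeven_of_char_257 K
  · exact not_holdsInDegree_of_choose_modEq_one K 257 (d := 98) (m := 18) (by norm_num) (by norm_num) (by decide)
  · exact not_holdsInDegree_ninetyNine_of_char_257 K
  · exact not_holdsInDegree_oneHundred_of_char_257 K
  · exact not_holdsInDegree_oneHundredOne_of_char_257 K
  · exact not_holdsInDegree_oneHundredTwo_of_char_257 K
  · exact not_holdsInDegree_of_choose_modEq_one K 257 (d := 103) (m := 48) (by norm_num) (by norm_num) (by decide)
  · exact not_holdsInDegree_oneHundredFour_of_char_257 K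
  · exact not_holdsInDegree_oneHundredFive_of_char_257 K
  · exact not_holdsInDegree_oneHundredSix_of_char_257 K
  · exact not_holdsInDegree_oneHundredSeven_of_char_257 K
  · exact not_holdsInDegree_oneHundredEight_of_char_257 K
  · exact not_holdsInDegree_oneHundredNine_of_char_257 K
  · exact not_holdsInDegree_oneHundredTen_of_char_257 K
  · exact not_holdsInDegree_of_choose_modEq_one K 257 (d := 111) (m := 17) (by norm_num) (by norm_num) (by decide)
  · exact not_holdsInDegree_oneHundredTwelve_of_char_257 K
  · exact not_holdsInDegree_oneHundredThirteen_of_char_257 K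
  · exact not_holdsInDegree_oneHundredFourteen_of_char_257 K
  · exact not_holdsInDegree_oneHundredFifteen_of_char_257 K
  · exact not_holdsInDegree_oneHundredSixteen_of_char_257 K
  · exact not_holdsInDegree_oneHundredSeventeen_of_char_257 K
  · exact not_holdsInDegree_of_choose_modEq_one K 257 (d := 118) (m := 12) (by norm_num) (by norm_num) (by decide)
  · exact not_holdsInDegree_oneHundredNineteen_of_char_257 K
  · exact not_holdsInDegree_oneHundredTwenty_of_char_257 K
  · exact not_holdsInDegree_oneHundredTwentyOne_of_char_257 K
  · exact not_holdsInDegree_oneHundredTwentyTwo_of_char_257 K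
  · exact not_holdsInDegree_oneHundredTwentyThree_of_char_257 K
  · exact not_holdsInDegree_oneHundredTwentyFour_of_char_257 K
  · exact not_holdsInDegree_of_choose_modEq_one K 257 (d := 125) (m := 33) (by norm_num) (by norm_num) (by decide)
  · exact not_holdsInDegree_oneHundredTwentySix_of_char_257 K
  · exact not_holdsInDegree_of_choose_modEq_one K 257 (d := 127) (m := 63) (by norm_num) (by norm_num) (by decide)
  · exact not_holdsInDegree_oneHundredTwentyEight_of_char_257 K
  · exact not_holdsInDegree_of_choose_modEq_one K 257 (d := 129) (m := 28) (by norm_num) (by norm_num) (by decide)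
  · exact not_holdsInDegree_oneHundredThirty_of_char_257 K
  · exact not_holdsInDegree_oneHundredThirtyOne_of_char_257 K
  · exact not_holdsInDegree_oneHundredThirtyTwo_of_char_257 K
  · exact not_holdsInDegree_oneHundredThirtyThree_of_char_257 K
  · exact not_holdsInDegree_oneHundredThirtyFour_of_char_257 K
  · exact not_holdsInDegree_oneHundredThirtyFive_of_char_257 K
  · exact not_holdsInDegree_oneHundredThirtySix_of_char_257 K
  · exact not_holdsInDegree_of_choose_modEq_one K 257 (d := 137) (m := 46) (by norm_num) (by norm_num) (by decide)
  · exact not_holdsInDegree_oneHundredThirtyEight_of_char_257 K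
  · exact not_holdsInDegree_oneHundredThirtyNine_of_char_257 K
  · exact not_holdsInDegree_oneHundredForty_of_char_257 K
  · exact not_holdsInDegree_of_choose_modEq_one K 257 (d := 141) (m := 25) (by norm_num) (by norm_num) (by decide)
  · exact not_holdsInDegree_oneHundredFortyTwo_of_char_257 K
  · exact not_holdsInDegree_oneHundredFortyThree_of_char_257 K
  · exact not_holdsInDegree_oneHundredFortyFour_of_char_257 K
  · exact not_holdsInDegree_of_choose_modEq_one K 257 (d := 145) (m := 37) (by norm_num) (by norm_num) (by decide)
  · exact not_holdsInDegree_of_choose_modEq_one K 257 (d := 146) (m := 53) (by norm_num) (by norm_num) (by decide)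
  · exact not_holdsInDegree_oneHundredFortySeven_of_char_257 K
  · exact not_holdsInDegree_oneHundredFortyEight_of_char_257 K
  · exact not_holdsInDegree_oneHundredFortyNine_of_char_257 K
  · exact not_holdsInDegree_of_choose_modEq_one K 257 (d := 150) (m := 12) (by norm_num) (by norm_num) (by decide)
  · exact not_holdsInDegree_oneHundredFiftyOne_of_char_257 K
  · exact not_holdsInDegree_oneHundredFiftyTwo_of_char_257 K
  · exact not_holdsInDegree_of_choose_modEq_one K 257 (d := 153) (m := 51) (by norm_num) (by norm_num) (by decide)
  · exact not_holdsInDegree_oneHundredFiftyFour_of_char_257 K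
  · exact not_holdsInDegree_of_choose_modEq_one K 257 (d := 155) (m := 28) (by norm_num) (by norm_num) (by decide)
  · exact not_holdsInDegree_oneHundredFiftySix_of_char_257 K
  · exact not_holdsInDegree_oneHundredFiftySeven_of_char_257 K
  · exact not_holdsInDegree_oneHundredFiftyEight_of_char_257 K
  · exact not_holdsInDegree_oneHundredFiftyNine_of_char_257 K
  · exact not_holdsInDegree_of_choose_modEq_one K 257 (d := 160) (m := 67) (by norm_num) (by norm_num) (by decide)
  · exact not_holdsInDegree_oneHundredSixtyOne_of_char_257 K
  · exact not_holdsInDegree_oneHundredSixtyTwo_of_char_257 K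
  · exact not_holdsInDegree_oneHundredSixtyThree_of_char_257 K
  · exact not_holdsInDegree_oneHundredSixtyFour_of_char_257 K
  · exact not_holdsInDegree_of_choose_modEq_one K 257 (d := 165) (m := 46) (by norm_num) (by norm_num) (by decide)
  · exact not_holdsInDegree_oneHundredSixtySix_of_char_257 K
  · exact not_holdsInDegree_oneHundredSixtySeven_of_char_257 K
  · exact not_holdsInDegree_oneHundredSixtyEight_of_char_257 K
  · exact not_holdsInDegree_of_choose_modEq_one K 257 (d := 169) (m := 61) (by norm_num) (by norm_num) (by decide)
  · exact not_holdsInDegree_oneHundredSeventy_of_char_257 K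
  · exact not_holdsInDegree_oneHundredSeventyOne_of_char_257 K
  · exact not_holdsInDegree_oneHundredSeventyTwo_of_char_257 K
  · exact not_holdsInDegree_oneHundredSeventyThree_of_char_257 K
  · exact not_holdsInDegree_oneHundredSeventyFour_of_char_257 K
  · exact not_holdsInDegree_oneHundredSeventyFive_of_char_257 K
  · exact not_holdsInDegree_of_choose_modEq_one K 257 (d := 176) (m := 18) (by norm_num) (by norm_num) (by decide)
  · exact not_holdsInDegree_oneHundredSeventySeven_of_char_257 K
  · exact not_holdsInDegree_oneHundredSeventyEight_of_char_257 K
  · exact not_holdsInDegree_oneHundredSeventyNine_of_char_257 K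
  · exact not_holdsInDegree_oneHundredEighty_of_char_257 K
  · exact not_holdsInDegree_oneHundredEightyOne_of_char_257 K
  · exact not_holdsInDegree_of_choose_modEq_one K 257 (d := 182) (m := 57) (by norm_num) (by norm_num) (by decide)
  · exact not_holdsInDegree_oneHundredEightyThree_of_char_257 K
  · exact not_holdsInDegree_oneHundredEightyFour_of_char_257 K
  · exact not_holdsInDegree_oneHundredEightyFive_of_char_257 K
  · exact not_holdsInDegree_oneHundredEightySix_of_char_257 K
  · exact not_holdsInDegree_oneHundredEightySeven_of_char_257 K
  · exact not_holdsInDegree_of_choose_modEq_one K 257 (d := 188) (m := 13) (by norm_num) (by norm_num) (by decide)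
  · exact not_holdsInDegree_of_choose_modEq_one K 257 (d := 189) (m := 3) (by norm_num) (by norm_num) (by decide)
  · exact not_holdsInDegree_oneHundredNinety_of_char_257 K
  · exact not_holdsInDegree_oneHundredNinetyOne_of_char_257 K
  · exact not_holdsInDegree_oneHundredNinetyTwo_of_char_257 K
  · exact not_holdsInDegree_of_choose_modEq_one K 257 (d := 193) (m := 64) (by norm_num) (by norm_num) (by decide)
  · exact not_holdsInDegree_oneHundredNinetyFour_of_char_257 K
  · exact not_holdsInDegree_of_choose_modEq_one K 257 (d := 195) (m := 87) (by norm_num) (by norm_num) (by decide)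
  · exact not_holdsInDegree_oneHundredNinetySix_of_char_257 K
  · exact not_holdsInDegree_oneHundredNinetySeven_of_char_257 K
  · exact not_holdsInDegree_of_choose_modEq_one K 257 (d := 198) (m := 41) (by norm_num) (by norm_num) (by decide)
  · exact not_holdsInDegree_of_choose_modEq_one K 257 (d := 199) (m := 5) (by norm_num) (by norm_num) (by decide)
  · exact not_holdsInDegree_twoHundred_of_char_257 K
  · exact not_holdsInDegree_of_choose_modEq_one K 257 (d := 201) (m := 31) (by norm_num) (by norm_num) (by decide)
  · exact not_holdsInDegree_of_choose_modEq_one K 257 (d := 202) (m := 18) (by norm_num) (by norm_num) (by decide)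
  · exact not_holdsInDegree_of_choose_modEq_one K 257 (d := 203) (m := 4) (by norm_num) (by norm_num) (by decide)
  · exact not_holdsInDegree_twoHundredFour_of_char_257 K
  · exact not_holdsInDegree_of_choose_modEq_one K 257 (d := 205) (m := 102) (by norm_num) (by norm_num) (by decide)
  · exact not_holdsInDegree_twoHundredSix_of_char_257 K
  · exact not_holdsInDegree_of_choose_modEq_one K 257 (d := 207) (m := 26) (by norm_num) (by norm_num) (by decide)
  · exact not_holdsInDegree_twoHundredEight_of_char_257 K
  · exact not_holdsInDegree_twoHundredNine_of_char_257 K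
  · exact not_holdsInDegree_twoHundredTen_of_char_257 K
  · exact not_holdsInDegree_twoHundredEleven_of_char_257 K
  · exact not_holdsInDegree_twoHundredTwelve_of_char_257 K
  · exact not_holdsInDegree_twoHundredThirteen_of_char_257 K
  · exact not_holdsInDegree_twoHundredFourteen_of_char_257 K
  · exact not_holdsInDegree_twoHundredFifteen_of_char_257 K
  · exact not_holdsInDegree_twoHundredSixteen_of_char_257 K
  · exact not_holdsInDegree_of_choose_modEq_one K 257 (d := 217) (m := 21) (by norm_num) (by norm_num) (by decide)
  · exact not_holdsInDegree_twoHundredEighteen_of_char_257 K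
  · exact not_holdsInDegree_of_choose_modEq_one K 257 (d := 219) (m := 108) (by norm_num) (by norm_num) (by decide)
  · exact not_holdsInDegree_twoHundredTwenty_of_char_257 K
  · exact not_holdsInDegree_twoHundredTwentyOne_of_char_257 K
  · exact not_holdsInDegree_twoHundredTwentyTwo_of_char_257 K
  · exact not_holdsInDegree_of_choose_modEq_one K 257 (d := 223) (m := 92) (by norm_num) (by norm_num) (by decide)
  · exact not_holdsInDegree_twoHundredTwentyFour_of_char_257 K
  · exact not_holdsInDegree_of_choose_modEq_one K 257 (d := 225) (m := 16) (by norm_num) (by norm_num) (by decide)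
  · exact not_holdsInDegree_of_choose_modEq_one K 257 (d := 226) (m := 65) (by norm_num) (by norm_num) (by decide)
  · exact not_holdsInDegree_of_choose_modEq_one K 257 (d := 227) (m := 67) (by norm_num) (by norm_num) (by decide)
  · exact not_holdsInDegree_twoHundredTwentyEight_of_char_257 K
  · exact not_holdsInDegree_twoHundredTwentyNine_of_char_257 K
  · exact not_holdsInDegree_twoHundredThirty_of_char_257 K
  · exact not_holdsInDegree_of_choose_modEq_one K 257 (d := 231) (m := 115) (by norm_num) (by norm_num) (by decide)
  · exact not_holdsInDegree_twoHundredThirtyTwo_of_char_257 K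
  · exact not_holdsInDegree_twoHundredThirtyThree_of_char_257 K
  · exact not_holdsInDegree_twoHundredThirtyFour_of_char_257 K
  · exact not_holdsInDegree_of_choose_modEq_one K 257 (d := 235) (m := 39) (by norm_num) (by norm_num) (by decide)
  · exact not_holdsInDegree_twoHundredThirtySix_of_char_257 K
  · exact not_holdsInDegree_of_choose_modEq_one K 257 (d := 237) (m := 64) (by norm_num) (by norm_num) (by decide)
  · exact not_holdsInDegree_of_choose_modEq_one K 257 (d := 238) (m := 54) (by norm_num) (by norm_num) (by decide)
  · exact not_holdsInDegree_of_choose_modEq_one K 257 (d := 239) (m := 94) (by norm_num) (by norm_num) (by decide)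
  · exact not_holdsInDegree_twoHundredForty_of_char_257 K
  · exact not_holdsInDegree_twoHundredFortyOne_of_char_257 K
  · exact not_holdsInDegree_twoHundredFortyTwo_of_char_257 K
  · exact not_holdsInDegree_twoHundredFortyThree_of_char_257 K
  · exact not_holdsInDegree_of_choose_modEq_one K 257 (d := 244) (m := 106) (by norm_num) (by norm_num) (by decide)
  · exact not_holdsInDegree_of_choose_modEq_one K 257 (d := 245) (m := 5) (by norm_num) (by norm_num) (by decide)
  · exact not_holdsInDegree_twoHundredFortySix_of_char_257 K
  · exact not_holdsInDegree_twoHundredFortySeven_of_char_257 K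
  · exact not_holdsInDegree_twoHundredFortyEight_of_char_257 K
  · exact not_holdsInDegree_of_choose_modEq_one K 257 (d := 249) (m := 32) (by norm_num) (by norm_num) (by decide)
  · exact not_holdsInDegree_twoHundredFifty_of_char_257 K
  · exact not_holdsInDegree_of_choose_modEq_one K 257 (d := 251) (m := 11) (by norm_num) (by norm_num) (by decide)
  · exact not_holdsInDegree_twoHundredFiftyTwo_of_char_257 K
  · exact not_holdsInDegree_of_choose_modEq_one K 257 (d := 253) (m := 67) (by norm_num) (by norm_num) (by decide)
  · exact not_holdsInDegree_twoHundredFiftyFour_of_char_257 K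
  · exact not_holdsInDegree_twoHundredFiftyFive_of_char_257 K
  · exact not_holdsInDegree_of_choose_modEq_one K 257 (d := 256) (m := 2) (by norm_num) (by norm_num) (by decide)

/-- the positive digits `1 ≤ a ≤ 5`: `CA_{a·257^k}` over every field of characteristic `257`. [cite: GrafVonBothmerEtAl2007, Props. 2, 6]
[cite: CastryckLaterveerOunaies2012, Thm. 4] -/
theorem holdsInDegree_mul_twoHundredFiftySeven_pow_of_le_five {a : ℕ} (ha0 : 0 < a) (ha5 : a ≤ 5) (k : ℕ) :
    HoldsInDegree K (a * 257 ^ k) := by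
  haveI : Fact (Nat.Prime 257) := ⟨by norm_num⟩
  interval_cases a
  · simpa using holdsInDegree_prime_pow_field K 257 k
  · exact holdsInDegree_two_mul_prime_pow_field K 257 k
  · exact holdsInDegree_three_mul_prime_pow_field K 257 (by norm_num) k
  · exact holdsInDegree_mul_prime_pow_field K 257
      (holdsInDegree_of_le_four_of_charP (AlgebraicClosure K) 257 (by norm_num) le_rfl) k
  · exact holdsInDegree_five_mul_prime_pow_field K 257 (by norm_num) (by norm_num) (by norm_num) (by norm_num)
      (by norm_num) (by norm_num) (by norm_num) (by norm_num) (by norm_num) k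

/-- **characteristic 257, complete**: over every field of characteristic `257`,
`CA_d ⟺ d = 0 ∨ d = a·257^k` with `a ∈ {1, 2, 3, 4, 5, 7}` — NOT an initial segment of digits (`6` is bad, `7` is good).
[cite: GrafVonBothmerEtAl2007, Props. 2, 6, 7] [cite: CastryckLaterveerOunaies2012, Thm. 4] -/
theorem classification_char_twoHundredFiftySeven_complete (d : ℕ) :
    HoldsInDegree K d ↔ d = 0 ∨ ∃ k a : ℕ, a ∈ ({1, 2, 3, 4, 5, 7} : Finset ℕ) ∧ d = a * 257 ^ k := by
  haveI : Fact (Nat.Prime 257) := ⟨by norm_num⟩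
  constructor
  · intro h
    rcases Nat.eq_zero_or_pos d with rfl | hd
    · exact Or.inl rfl
    obtain ⟨k, a, ha0, hap, rfl, ha⟩ := digit_of_holdsInDegree K 257 hd.ne' h
    refine Or.inr ⟨k, a, ?_, rfl⟩
    by_cases ha5 : a ≤ 5
    · interval_cases a <;> simp
    · by_cases ha6 : a = 6
      · subst ha6
        exact absurd ha (not_holdsInDegree_six_of_char_257 K)
      · by_cases ha7 : a = 7
        · subst ha7
          simp
        · exfalso
          exact not_holdsInDegree_digit_of_char_twoHundredFiftySeven K (by omega) hap ha
  · rintro (rfl | ⟨k, a, ha, rfl⟩)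
    · exact holdsInDegree_zero K
    · simp only [Finset.mem_insert, Finset.mem_singleton] at ha
      rcases ha with rfl | rfl | rfl | rfl | rfl | rfl
      · exact holdsInDegree_mul_twoHundredFiftySeven_pow_of_le_five K (by norm_num) (by norm_num) k
      · exact holdsInDegree_mul_twoHundredFiftySeven_pow_of_le_five K (by norm_num) (by norm_num) k
      · exact holdsInDegree_mul_twoHundredFiftySeven_pow_of_le_five K (by norm_num) (by norm_num) k
      · exact holdsInDegree_mul_twoHundredFiftySeven_pow_of_le_five K (by norm_num) (by norm_num) k
      · exact holdsInDegree_mul_twoHundredFiftySeven_pow_of_le_five K (by norm_num) (by norm_num) k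
      · exact holdsInDegree_seven_mul_pow_of_char_257 (K := K) k

/-- the same classification in interval form (`1 ≤ a ≤ 7`, `a ≠ 6`), convenient for one-statement summaries over several characteristics.
[cite: GrafVonBothmerEtAl2007, Props. 2, 6, 7] [cite: CastryckLaterveerOunaies2012, Thm. 4] -/
theorem classification_char_twoHundredFiftySeven_complete' (d : ℕ) :
    HoldsInDegree K d ↔ d = 0 ∨ ∃ k a : ℕ, 0 < a ∧ a ≤ 7 ∧ a ≠ 6 ∧ d = a * 257 ^ k := by
  rw [classification_char_twoHundredFiftySeven_complete]
  have key : ∀ a : ℕ, a ∈ ({1, 2, 3, 4, 5, 7} : Finset ℕ) ↔ 0 < a ∧ a ≤ 7 ∧ a ≠ 6 := by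
    intro a
    simp only [Finset.mem_insert, Finset.mem_singleton]
    omega
  simp only [key, and_assoc]

/-- **`CA_7` holds but `CA_6` fails** over every field of characteristic `257` — the first prime characteristic with a good digit above a bad one
of this kind (`257` is a bad prime for degree `6` and a good prime for degree `7`). [cite: CastryckLaterveerOunaies2012, Thm. 4] -/
theorem holdsInDegree_seven_and_not_six_of_char_257 : HoldsInDegree K 7 ∧ ¬ HoldsInDegree K 6 :=
  ⟨by simpa using holdsInDegree_seven_mul_pow_of_char_257 (K := K) 0, not_holdsInDegree_six_of_char_257 K⟩

/-- the set of Casas-Alvero degrees `≤ 66049` in characteristic `257`, explicitly (corollary of the classification: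
[cite: GrafVonBothmerEtAl2007, Prop. 6] with [cite: CastryckLaterveerOunaies2012, Thm. 4] and the digit refutations above). -/
theorem holdsInDegree_iff_mem_of_le_char_twoHundredFiftySeven_sq {d : ℕ} (hd : d ≤ 66049) :
    HoldsInDegree K d ↔ d ∈ ({0, 1, 2, 3, 4, 5, 7, 257, 514, 771, 1028, 1285, 1799, 66049} : Finset ℕ) := by
  rw [classification_char_twoHundredFiftySeven_complete]
  constructor
  · rintro (rfl | ⟨k, a, ha, rfl⟩)
    · decide
    · simp only [Finset.mem_insert, Finset.mem_singleton] at ha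
      rcases k with _ | _ | _ | k
      · rcases ha with rfl | rfl | rfl | rfl | rfl | rfl <;> decide
      · rcases ha with rfl | rfl | rfl | rfl | rfl | rfl <;> decide
      · rcases ha with rfl | rfl | rfl | rfl | rfl | rfl <;> simp_all
      · exfalso
        have ha0 : 0 < a := by rcases ha with rfl | rfl | rfl | rfl | rfl | rfl <;> norm_num
        have : 257 ^ 3 ≤ a * 257 ^ (k + 1 + 1 + 1) :=
          le_trans (Nat.pow_le_pow_right (by norm_num) (by omega)) (Nat.le_mul_of_pos_left _ ha0)
        omega
  · intro h
    simp only [Finset.mem_insert, Finset.mem_singleton] at h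
    rcases h with rfl | rfl | rfl | rfl | rfl | rfl | rfl | rfl | rfl | rfl | rfl | rfl | rfl | rfl
    · exact Or.inl rfl
    · exact Or.inr ⟨0, 1, by simp, by norm_num⟩
    · exact Or.inr ⟨0, 2, by simp, by norm_num⟩
    · exact Or.inr ⟨0, 3, by simp, by norm_num⟩
    · exact Or.inr ⟨0, 4, by simp, by norm_num⟩
    · exact Or.inr ⟨0, 5, by simp, by norm_num⟩
    · exact Or.inr ⟨0, 7, by simp, by norm_num⟩
    · exact Or.inr ⟨1, 1, by simp, by norm_num⟩
    · exact Or.inr ⟨1, 2, by simp, by norm_num⟩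
    · exact Or.inr ⟨1, 3, by simp, by norm_num⟩
    · exact Or.inr ⟨1, 4, by simp, by norm_num⟩
    · exact Or.inr ⟨1, 5, by simp, by norm_num⟩
    · exact Or.inr ⟨1, 7, by simp, by norm_num⟩
    · exact Or.inr ⟨2, 1, by simp, by norm_num⟩

end CharTwoHundredFiftySeven

end Literature.Algebra.Polynomial.CasasAlvero
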